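import Mathlib
import Literature.Probability.RandomPlanarGeometry.HexParafermion
import Literature.Probability.RandomPlanarGeometry.HexSAW
import Summits.CriticalPhenomena.SAWScalingLimit.Theses.SAWDefectDecoherence

/-!
# Sketch — crux idea `bridge-gate-renewal` for crux `ObservableToSLER` (stmt-CriticalPhenomena-14005)

First lemma (provable now, M): the EXACT factorisation of the critical SAW mass at a gate that is
crossed exactly once ("bridge gate"): if the vertex set of a hexagonal domain is partitioned as
`Λa ⊔ Λb` and a mid-edge walk from a mid-edge on the `Λa` side to a mid-edge on the `Λb` side uses
EXACTLY ONE lattice edge joining `Λa` to `Λb`, namely `{p, q}`, then it is the concatenation (at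
the mid-edge `{p, q}`) of a walk of the domain `Λa` ending at its boundary mid-edge `{p,q}` and a walk
of the domain `Λb` starting at its boundary mid-edge `{p,q}`, the vertex counts add, and conversely;
hence the `x^ℓ`-mass factorises as the product of the two spin-0 observables.  (Kesten's bridge
renewal, radialised: the honeycomb analogue of "at a break point the gap above its column is crossed
exactly once", `Literature.Probability.RandomPlanarGeometry.SAW.Zd` word bridges.)

The load-bearing OPEN input of the idea (`GateAbundance`) is stated in the card in prose; its shape
over abstract data is typed below as `GateAbundanceShape` (nested gates around the root).
-/

open Literature.Probability.RandomPlanarGeometry Literature.Probability.RandomPlanarGeometry.SAW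
  Literature.Probability.LatticeModels
open scoped Classical BigOperators

namespace Summit.CriticalPhenomena.SAWScalingLimit.Cruxes.ObservableToSLER.BridgeGate

/-- The lattice edges traversed by a mid-edge walk between consecutive visited vertices. -/
noncomputable def innerEdges {Λ : Finset HexVertex} {a z : Sym2 HexVertex}
    (γ : HexMidEdgeSAW Λ a z) : List (Sym2 HexVertex) :=
  List.zipWith (fun u w => s(u, w)) γ.verts γ.verts.tail

/-- The gate of a partition: the lattice edges joining `Λa` to `Λb`. -/
def gateEdges (Λa Λb : Finset HexVertex) : Set (Sym2 HexVertex) :=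
  {e | ∃ u ∈ Λa, ∃ w ∈ Λb, hexGraph.Adj u w ∧ e = s(u, w)}

/-- Number of gate edges used by a walk of the union domain. -/
noncomputable def gateCrossings (Λa Λb : Finset HexVertex) {a z : Sym2 HexVertex}
    (γ : HexMidEdgeSAW (Λa ∪ Λb) a z) : ℕ :=
  ((innerEdges γ).filter (fun e => e ∈ gateEdges Λa Λb)).length

/-- **First lemma — `GateFactorisation` (exact, every fugacity `x`).**  For disjoint `Λa, Λb`,
adjacent `p ∈ Λa`, `q ∈ Λb`, a start mid-edge `a` touching no vertex of `Λb` and an end mid-edge `z`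
touching no vertex of `Λa`: the `x^{ℓ}`-mass of the walks of `Λa ∪ Λb` from `a` to `z` whose only
gate edge is `{p,q}` equals `Z_{Λa}(a → {p,q}) · Z_{Λb}({p,q} → z)`, the spin-`0` observables. -/
def GateFactorisation : Prop :=
  ∀ (Λa Λb : Finset HexVertex), Disjoint Λa Λb →
    ∀ (a z : Sym2 HexVertex) (p q : HexVertex), p ∈ Λa → q ∈ Λb → hexGraph.Adj p q →
      (∀ v ∈ a, v ∉ Λb) → (∀ v ∈ z, v ∉ Λa) → ∀ x : ℝ,
        (∑ γ ∈ (Finset.univ : Finset (HexMidEdgeSAW (Λa ∪ Λb) a z)).filter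
            (fun γ => (innerEdges γ).filter (fun e => e ∈ gateEdges Λa Λb) = [s(p, q)]),
          (x : ℂ) ^ γ.length)
        = hexParafermionicObservable Λa a x 0 s(p, q) * hexParafermionicObservable Λb s(p, q) x 0 z

/-- Corollary shape used by the idea (restriction at a bridge gate, EXACT): the conditional law of
the part of the walk after the unique gate crossing is the critical SAW law of the sub-domain `Λb`
rooted at the crossing mid-edge — stated as an identity of masses for every event `E` on the
`Λb`-walks. -/
def GateConditionalLaw : Prop :=
  ∀ (Λa Λb : Finset HexVertex), Disjoint Λa Λb →
    ∀ (a z : Sym2 HexVertex) (p q : HexVertex), p ∈ Λa → q ∈ Λb → hexGraph.Adj p q →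
      (∀ v ∈ a, v ∉ Λb) → (∀ v ∈ z, v ∉ Λa) →
      ∀ (E : HexMidEdgeSAW Λb s(p, q) z → Prop) (x : ℝ),
        (∑ γ ∈ (Finset.univ : Finset (HexMidEdgeSAW (Λa ∪ Λb) a z)).filter
            (fun γ => (innerEdges γ).filter (fun e => e ∈ gateEdges Λa Λb) = [s(p, q)] ∧
              ∃ γb : HexMidEdgeSAW Λb s(p, q) z, E γb ∧ γb.verts = γ.verts.filter (· ∈ Λb)),
          (x : ℂ) ^ γ.length)
        = hexParafermionicObservable Λa a x 0 s(p, q) *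
            ∑ γb ∈ (Finset.univ : Finset (HexMidEdgeSAW Λb s(p, q) z)).filter (fun γb => E γb),
              (x : ℂ) ^ γb.length

/-- Shape of the load-bearing lattice input `GateAbundance` over ABSTRACT nested gates (the card's
prose version uses the boundary arcs of lattice hexagons `H(a, n)`, `nδ ∈ (r, √r)`, around the
root): given a finite increasing chain of root-side vertex sets `A 0 ⊆ A 1 ⊆ ⋯ ⊆ A J ⊆ Λ` (the
root-side components cut out by the nested gates) with the root inside `A 0` and the target outside
`A J`, the critical mass of walks that cross NO gate exactly once is at most `ε` times the total
mass. (The real statement quantifies: ∀ ε ∃ window size, uniformly in the mesh; here only the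
shape.) -/
def GateAbundanceShape (ε : ℝ) (Λ : Finset HexVertex) (a b : Sym2 HexVertex) (J : ℕ)
    (A : ℕ → Finset HexVertex) : Prop :=
  (∀ j, j < J → A j ⊆ A (j + 1)) → A J ⊆ Λ → (∀ v ∈ a, v ∈ Λ → v ∈ A 0) → (∀ v ∈ b, v ∉ A J) →
    (∑ γ ∈ (Finset.univ : Finset (HexMidEdgeSAW Λ a b)).filter
        (fun γ => ∀ j ≤ J,
          ((innerEdges γ).filter (fun e => e ∈ gateEdges (A j) (Λ \ A j))).length ≠ 1),
      (hexCriticalFugacity : ℂ) ^ γ.length).re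
    ≤ ε * (hexParafermionicObservable Λ a hexCriticalFugacity 0 b).re

end Summit.CriticalPhenomena.SAWScalingLimit.Cruxes.ObservableToSLER.BridgeGate
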